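import Literature.MathematicalPhysics.QuantumFieldTheory.Balaban1983to89.T4OutputRate

/-!
# OutputRateWindow — `T4OutputRate.NE5` is POINTWISE in the coupling sequence and ADDITIVE in the functional pair: window
# restriction ∕ reassembly from singleton windows, and the sum face for functionals read on one carrier
# (cell `pub-balaban`, T⁴ fan-out, `HOME/BINDER-OWNERS.md` row NE5, owner lineage t4-ne5-p1, gen 30; ruling R24 and route P3's QB4)

HONEST FRAMING (T4-DAG PAGE 1).  Rung (B)+1 on ONE finite four-torus of fixed physical size — NOT infinite volume, NOT a mass gap, NOT
the Clay problem; `FlowStep.BetaPertH`, (B), (B^μ) do not occur here.  NE5 is NOT PRINTED and NOT PROVED (spine 0/9, unchanged).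
Nothing of Bałaban's series is asserted; 0 cite tags.  HONEST DEPENDENCY (cell, verbatim): continuum YM on T⁴ ⇐ BetaPertH ∧ nine spine
estimates (0/9 proved); BetaPertH ⇐ (D1) ∧ (D4) ∧ CAP+tail; G-an2-4 gates asym, D1 and NE2/3/4.

WHY (ruling R24, owner gen 30).  In every termwise END face of route P1 the term family `T k i o h X` and — in the (2.14) dictionary
`OutputRateGaussianParamBi.TermGaussianParamBi` — its data `lam, w, N, F₀, Λ, q, …` carry NO coupling-sequence index: all `g`-dependence
of the step flows through the DATA `(o, h)`.  A factor that depends on `g` but is neither an operator species nor a history entry (the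
located example: the small-field thresholds `p(g_k)` inside the characteristic functions, which sit in the `o`-INDEPENDENT slot `F₀`)
is therefore expressible only on a window on which it is constant.  This costs nothing: `NE5 EA EB W κ θ C₅` quantifies `∀ g ∈ W`
OUTERMOST, so it is EQUIVALENT to its restriction to every singleton `{g}`, `g ∈ W` (`ne5_iff_forall_singleton`), and every other
displayed binder of the END faces is a `∀ g ∈ W` statement, antitone in `W`.  RULE: instantiate per singleton window with `g`-indexed
dictionaries and the `g`-UNIFORM constants of the END face, then reassemble (`ne5_of_forall_singleton`).  QB4 (route P3's design note
`B14BoundaryStepDesign.md` §6): the regular channel reads the SUM of the E-member and the R-member; `NE5` for a sum of functional pairs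
on one carrier is `ne5_add` (constants add; `ne5_add_max`: `2·max`).

WHAT THIS MODULE IS.  `ne5_antitone_window`, `ne5_iff_forall_singleton`, `ne5_of_forall_singleton`, `ne5_add`, `ne5_add_max`,
`ne5_neg`, `ne5_sub`, `ne5_zero`.  Bookkeeping/[folklore]; no estimate; 0 sorry; axioms ⊆ {propext, Classical.choice, Quot.sound}.
-/

namespace Summit.QuantumFields.BalabanUV.T4Continuum.OutputRateWindow

open Literature.MathematicalPhysics.QuantumFieldTheory.Balaban1983to89.T4OutputRate

variable {C : Carriers} {EA EA' : Functional C C.BgA} {EB EB' : Functional C C.BgB} {W W' : Set (ℕ → ℝ)} {κ θ C₅ C₅' : ℝ}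

/-- `NE5` is ANTITONE in the window: it restricts to any sub-window. [folklore] -/
theorem ne5_antitone_window (h : NE5 EA EB W κ θ C₅) (hW : W' ⊆ W) : NE5 EA EB W' κ θ C₅ :=
  fun g hg U X => h g (hW hg) U X

/-- **`NE5` IS POINTWISE IN THE COUPLING SEQUENCE**: `NE5 EA EB W κ θ C₅ ↔ ∀ g ∈ W, NE5 EA EB {g} κ θ C₅` (ruling R24: instantiate per
singleton window with `g`-indexed dictionaries, constants uniform in `g`). [folklore] -/
theorem ne5_iff_forall_singleton : NE5 EA EB W κ θ C₅ ↔ ∀ g ∈ W, NE5 EA EB {g} κ θ C₅ :=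
  ⟨fun h _ hg => ne5_antitone_window h (Set.singleton_subset_iff.2 hg),
    fun h g hg U X => h g hg g (Set.mem_singleton g) U X⟩

/-- Reassembly from singleton windows (the direction the instancer uses). [folklore] -/
theorem ne5_of_forall_singleton (h : ∀ g ∈ W, NE5 EA EB {g} κ θ C₅) : NE5 EA EB W κ θ C₅ :=
  ne5_iff_forall_singleton.2 h

/-- **QB4 — `NE5` IS ADDITIVE IN THE FUNCTIONAL PAIR**: the pointwise sum of two pairs read on the same carriers obeys `NE5` with the sum
of the constants (same window, same `κ`, same rate `θ`). [folklore] -/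
theorem ne5_add (h : NE5 EA EB W κ θ C₅) (h' : NE5 EA' EB' W κ θ C₅') :
    NE5 (EA + EA') (EB + EB') W κ θ (C₅ + C₅') := by
  intro g hg U X
  have e : (EA + EA') g (C.transport U) X - (EB + EB') g U X =
      (EA g (C.transport U) X - EB g U X) + (EA' g (C.transport U) X - EB' g U X) := by
    simp only [Pi.add_apply]; ring
  rw [e, add_mul, add_mul]
  exact (abs_add_le _ _).trans (add_le_add (h g hg U X) (h' g hg U X))

/-- The sum face with ONE constant: `2·max C₅ C₅′` (route P3's «CE := max» up to the factor 2; `0 ≤ θ`). [folklore] -/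
theorem ne5_add_max (h : NE5 EA EB W κ θ C₅) (h' : NE5 EA' EB' W κ θ C₅') (hθ : 0 ≤ θ) :
    NE5 (EA + EA') (EB + EB') W κ θ (2 * max C₅ C₅') := by
  intro g hg U X
  refine (ne5_add h h' g hg U X).trans (mul_le_mul_of_nonneg_right (mul_le_mul_of_nonneg_right ?_ (pow_nonneg hθ _))
    (Real.exp_pos _).le)
  rw [two_mul]
  exact add_le_add (le_max_left _ _) (le_max_right _ _)

/-- `NE5` for the negated pair (same constant). [folklore] -/
theorem ne5_neg (h : NE5 EA EB W κ θ C₅) : NE5 (-EA) (-EB) W κ θ C₅ := by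
  intro g hg U X
  have e : (-EA) g (C.transport U) X - (-EB) g U X = -(EA g (C.transport U) X - EB g U X) := by
    simp only [Pi.neg_apply]; ring
  rw [e, abs_neg]
  exact h g hg U X

/-- `NE5` for the difference of two pairs (constants add). [folklore] -/
theorem ne5_sub (h : NE5 EA EB W κ θ C₅) (h' : NE5 EA' EB' W κ θ C₅') :
    NE5 (EA - EA') (EB - EB') W κ θ (C₅ + C₅') := by
  simpa only [sub_eq_add_neg] using ne5_add h (ne5_neg h')

/-- The zero pair obeys `NE5` with constant `0`. [folklore] -/
theorem ne5_zero : NE5 (0 : Functional C C.BgA) (0 : Functional C C.BgB) W κ θ 0 := by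
  intro g _ U X
  simp

end Summit.QuantumFields.BalabanUV.T4Continuum.OutputRateWindow
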